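import Mathlib
import HarnessLib
import Summits.BirchSwinnertonDyer.BirchSwinnertonDyer.Theses.ManinLocalTwoThree
import Summits.BirchSwinnertonDyer.Rank1Residual.ManinAdditive.NeronOmegaThreeFrickeTrace
import Literature.NumberTheory.EllipticCurves.ModularCurveNonempty

/-!
# Lines/ghost_duality.lean — v1 (planner-of-record bsd-f2-manin-imc g23, 2026-08-29T08:5xZ): a SECOND skeleton line for C3
# `ManinPrimeToThreeAtNine` (stmt-BirchSwinnertonDyer-22968), alongside the line of record `kato_shift_three` (LEAD p1) — not a replacement.

IDEA (crux idea `ghost-duality-3`, Cruxes/ManinPrimeToThreeAtNine/Ideas/ghost-duality-3.md; MEMO-imc §29; HOME/imc/kit-g23/PROOFS-g23.md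
33565cb1cbe02bd9): on the Česnavičius–Neururer–Saha rational-singularity range {9 ∣ N, 81 ∤ N, (27 ∤ N ∨ some prime p' ≡ 2 mod 3 divides N)}
the Manin constant at 3 is bounded by the REDUCED-COMPONENT DEFECT, ord₃(c_φ) ≤ σ^red(φ) := ord₃ deg φ − ord₃ [e_f (S ∩ w₉S) : ℤ f]
(THEOREM 29.M on paper: Grothendieck duality on the normal Katz–Mazur model + «the additive Néron model is a 𝔾_a and maps trivially to
the (semi-)abelian Picard variety of the ghost component» ⟹ ghost defect ≤ Lie defect), so that C3 on the range is EXACTLY the cell's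
E-blind census law E-imc-161 `RedDepthEqModularDegreeAtThree` (σ^red = 0 for the optimal φ; 670/670 + 436/436, two engines).

FOUR STUBS:
* `stub_threeDvdManinForcesRedDefect` — E-imc-177 (THEOREM 29.M typed contrapositively; paper theorem with printed inputs KM 5.1.1/8.6/13.4.7,
  Grothendieck duality, Bruns–Herzog 3.3.10, BLR ch. 8–9, Raynaud/ČNS rat-sing criterion «p = 3 and either val_p(N) ≤ 2 or there is a prime
  p' ∣ N with p' ≡ 2 mod 3», Chevalley; referee audit R-imc-70 pending; the typer files it as `NeronOmegaGenusG23.ThreeDvdManinForcesRedDefectAtThree`,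
  T-imc-35 — this stub's type is that node's body VERBATIM).
* `stub_redDepthEqModularDegree` — E-imc-161 BY NAME (the load-bearing OPEN stub: an E-blind statement about one explicit Hecke lattice).
* `stub_modularDegree_le_of_latticeOptimal` — transport: a LATTICE-optimal datum (Λ_W = c·Λ_f) has minimal modular degree among all data
  with the same newform (φ' = [c'] ∘ φ_f factors through ℂ/Λ_f ≅ W(ℂ); folklore, M-sized over `deg_spec`).
* `stub_residual` — C3 restricted to the COMPLEMENT of the range inside 9 ∣ N: 81 ∣ N, or 27 ∣ N with no prime factor ≡ 2 mod 3
  (N = 189, 351, 513, 837, 999, …) — left to the line of record's machinery (Γ₁ lever + hex + residual descent) or to a future 81 ∣ N engine.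
COMPOSITION `ManinPrimeToThreeAtNine_of`: Carayol-from-modularity (`ModularParametrizationData.level_eq_conductorNorm_of_exists`, a tree
THEOREM fed by C3's own hypothesis `exists_isNewformOf`) pins N = N_W; case split on the range; on it E-177 ∧ E-161 ∧ transport give
3 ∤ c (COROLLARY 29.N); off it `stub_residual`.  Kernel-checked, no sorry outside `stub_*`.
HONEST FRAMING: nothing about BSD is proved by this line; Manin's conjecture at 3 is not proved by it; C3 becomes, on the rat-sing range,
a CONDITIONAL reduction to ONE paper theorem (29.M, audit pending) plus ONE open E-blind lattice law (E-161) plus a folklore transport,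
and stays the residual statement off the range.
-/

open scoped MatrixGroups ModularForm
open CongruenceSubgroup Literature.NumberTheory.EllipticCurves.ModularForms
  Summit.BirchSwinnertonDyer.Rank1Residual.ManinAdditive
  Summit.BirchSwinnertonDyer.Rank1Residual.ManinAdditive.NeronOmegaThree

namespace Summit.BirchSwinnertonDyer.BirchSwinnertonDyer.Cruxes.ManinPrimeToThreeAtNine.GhostDuality

/-- STUB 1 = E-imc-177 `ThreeDvdManinForcesRedDefectAtThree` (THEOREM 29.M, PROOFS-g23 §5.4, typed contrapositively): for an optimal `E` of
conductor `N` with `9 ∣ N`, `81 ∤ N`, on the rational-singularity range, `3 ∣ c_E` forces `ord₃ [e_f L_red : ℤ f] < ord₃ deg φ`. -/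
theorem stub_threeDvdManinForcesRedDefect :
    ∀ (W : WeierstrassCurve ℚ) [W.IsElliptic] [W.IsGloballyMinimal] [NeZero (W.conductorNorm ℤ)]
      (D : ModularParametrizationData W (W.conductorNorm ℤ)),
      (∀ z ∈ D.L.lattice, ∃ w ∈ periodLattice D.f, z = D.c * w) →
      9 ∣ W.conductorNorm ℤ → ¬ 81 ∣ W.conductorNorm ℤ →
      (¬ 27 ∣ W.conductorNorm ℤ ∨ ∃ p : ℕ, p.Prime ∧ p ∣ W.conductorNorm ℤ ∧ p % 3 = 2) →
      (3 : ℤ) ∣ D.maninConstant →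
        padicValNat 3 (lineIndex (drLatticeAtThree (W.conductorNorm ℤ)) D.f) < padicValNat 3 D.modularDegree := by
  sorry

/-- STUB 2 = E-imc-161 `RedDepthEqModularDegreeAtThree` BY NAME (the open, E-blind, load-bearing stub; census 670/670 + 436/436). -/
theorem stub_redDepthEqModularDegree : RedDepthEqModularDegreeAtThree := by
  sorry

/-- STUB 3 (transport, folklore): a lattice-optimal datum has minimal modular degree among all data of level `N` with the same newform. -/
theorem stub_modularDegree_le_of_latticeOptimal :
    ∀ (W : WeierstrassCurve ℚ) [W.IsElliptic] {N : ℕ} [NeZero N] (D : ModularParametrizationData W N),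
      (∀ z ∈ D.L.lattice, ∃ w ∈ periodLattice D.f, z = D.c * w) →
      ∀ (W' : WeierstrassCurve ℚ) [W'.IsElliptic] (D' : ModularParametrizationData W' N),
        D'.f = D.f → D.modularDegree ≤ D'.modularDegree := by
  sorry

/-- STUB 4 (residual): C3 off the rational-singularity range inside `9 ∣ N` — `81 ∣ N`, or `27 ∣ N` with no prime factor `≡ 2 mod 3`. -/
theorem stub_residual :
    Literature.NumberTheory.EllipticCurves.ModularForms.mazur_not_dvd_maninConstant_of_odd →
    Literature.NumberTheory.EllipticCurves.ModularForms.abbesUllmo_not_dvd_maninConstant_of_not_dvd_level →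
    Literature.NumberTheory.EllipticCurves.ModularForms.cesnavicius_not_two_dvd_maninConstant_of_two_dvd_level →
    Literature.NumberTheory.EllipticCurves.ModularForms.exists_isNewformOf →
    ∀ (W : WeierstrassCurve ℚ) [W.IsElliptic] [W.IsGloballyMinimal] {N : ℕ} [NeZero N]
      (D : ModularParametrizationData W N),
      (∀ z ∈ D.L.lattice, ∃ w ∈ periodLattice D.f, z = D.c * w) → 3 ^ 2 ∣ N →
      (81 ∣ N ∨ (27 ∣ N ∧ ∀ p : ℕ, p.Prime → p ∣ N → p % 3 ≠ 2)) →
      ¬ (3 : ℤ) ∣ D.maninConstant := by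
  sorry

/-- COMPOSITION (kernel-checked; COROLLARY 29.N on the range + the residual stub off it). -/
theorem ManinPrimeToThreeAtNine_of
    (h177 : ∀ (W : WeierstrassCurve ℚ) [W.IsElliptic] [W.IsGloballyMinimal] [NeZero (W.conductorNorm ℤ)]
      (D : ModularParametrizationData W (W.conductorNorm ℤ)),
      (∀ z ∈ D.L.lattice, ∃ w ∈ periodLattice D.f, z = D.c * w) →
      9 ∣ W.conductorNorm ℤ → ¬ 81 ∣ W.conductorNorm ℤ →
      (¬ 27 ∣ W.conductorNorm ℤ ∨ ∃ p : ℕ, p.Prime ∧ p ∣ W.conductorNorm ℤ ∧ p % 3 = 2) →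
      (3 : ℤ) ∣ D.maninConstant →
        padicValNat 3 (lineIndex (drLatticeAtThree (W.conductorNorm ℤ)) D.f) < padicValNat 3 D.modularDegree)
    (h161 : RedDepthEqModularDegreeAtThree)
    (hdeg : ∀ (W : WeierstrassCurve ℚ) [W.IsElliptic] {N : ℕ} [NeZero N] (D : ModularParametrizationData W N),
      (∀ z ∈ D.L.lattice, ∃ w ∈ periodLattice D.f, z = D.c * w) →
      ∀ (W' : WeierstrassCurve ℚ) [W'.IsElliptic] (D' : ModularParametrizationData W' N),
        D'.f = D.f → D.modularDegree ≤ D'.modularDegree)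
    (hres : Literature.NumberTheory.EllipticCurves.ModularForms.mazur_not_dvd_maninConstant_of_odd →
      Literature.NumberTheory.EllipticCurves.ModularForms.abbesUllmo_not_dvd_maninConstant_of_not_dvd_level →
      Literature.NumberTheory.EllipticCurves.ModularForms.cesnavicius_not_two_dvd_maninConstant_of_two_dvd_level →
      Literature.NumberTheory.EllipticCurves.ModularForms.exists_isNewformOf →
      ∀ (W : WeierstrassCurve ℚ) [W.IsElliptic] [W.IsGloballyMinimal] {N : ℕ} [NeZero N]
        (D : ModularParametrizationData W N),
        (∀ z ∈ D.L.lattice, ∃ w ∈ periodLattice D.f, z = D.c * w) → 3 ^ 2 ∣ N →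
        (81 ∣ N ∨ (27 ∣ N ∧ ∀ p : ℕ, p.Prime → p ∣ N → p % 3 ≠ 2)) →
        ¬ (3 : ℤ) ∣ D.maninConstant) :
    Summit.BirchSwinnertonDyer.BirchSwinnertonDyer.Theses.ManinLocalTwoThree.ManinPrimeToThreeAtNine := by
  intro hMaz hAU hCes hEx W _ _ N _ D hL h9
  by_cases hrange : ¬ 81 ∣ N ∧ (¬ 27 ∣ N ∨ ∃ p : ℕ, p.Prime ∧ p ∣ N ∧ p % 3 = 2)
  · obtain ⟨h81, hrs⟩ := hrange
    have hN : N = W.conductorNorm ℤ := ModularParametrizationData.level_eq_conductorNorm_of_exists hEx D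
    subst hN
    intro h3
    have h9' : 9 ∣ W.conductorNorm ℤ := by norm_num at h9; exact h9
    have hlt := h177 W D hL h9' h81 hrs h3
    rw [h161 W D hL (hdeg W D hL) h9' h81] at hlt
    exact lt_irrefl _ hlt
  · refine hres hMaz hAU hCes hEx W D hL h9 ?_
    by_cases h81 : 81 ∣ N
    · exact Or.inl h81
    · refine Or.inr ⟨?_, ?_⟩
      · by_contra h27
        exact hrange ⟨h81, Or.inl h27⟩
      · intro p hp hpN hp3
        exact hrange ⟨h81, Or.inr ⟨p, hp, hpN, hp3⟩⟩

end Summit.BirchSwinnertonDyer.BirchSwinnertonDyer.Cruxes.ManinPrimeToThreeAtNine.GhostDuality
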